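import Summits.RiemannHypothesis.RiemannHypothesis.Theorems.TiltedLandingLaw421R3PurseNodes
import Summits.RiemannHypothesis.RiemannHypothesis.Theorems.TiltedLandingLaw421R3PurseHalfX

/-! # law421 RATE^B SOCKET SPLIT at the ½ purse — `…R3RateSplit` (C2 «constants / budget / pricing» rh-idea-2 g41; (CA422))
SUPPORT module (fully proved, no `sorry`; lands `--supports stmt-RiemannHypothesis-33346 --as helper`: proves no stub, no crux).
Director (CA422) PLAN OF RECORD for the RATE^B stub `stub_restRateBotQP : RestRateBotPQ halfPurse` of registry
`Cruxes/TiltedLandingLaw421R/Lines/trkD_v4q.lean` e5616fe7 = the merged endgame map `pub/ideators/rh-idea-2/g41/w08s/doc/RATEB-endgame-map-MERGED-g41.md`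
0f52d273 (§2 composition kernel-checked in scratch 9aa318ac).  This file is the RESIDUAL-DESIGNATE of that plan:
* `RateLawsHalfQ` — ONE closed statement = the four OPEN law sockets F1 / F2 / C / A of the map, energy form:
  F1 ⇒ `FarEnergyLawCQ (4/5)` (far levels pay `(4/5)·s²` of Jensen energy: `RhW08.FarStep.nested_step_energy_eta` + `aloft_of_not_readyR2` once the
  far field / END datum is controlled at level `j`), F2 `EnergyRiseLawQ aR` (pre-horizon rises of `lowH`), C `ConsLawQ aC` (consumption levels net of
  tent credits), ★A `ApproachAllowanceQ (S₀ − (5/4)(energyPurseQ + aR) − aC + (B+1)/2)` (the approach class is paid by the CAPITAL incl. the ½ void charge —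
  the real gap; in-model every census of record certifies the SUM at κ = ½: critic 0/53, C2 TABLE-half 0/158 min margin +12, C6 0/1 288);
* `restRateBotPQ_half_of_rateLaws : RateLawsHalfQ → RestRateBotPQ halfPurse` (the stub text from the laws; body = `restRateBotPQ_of_energyLawC` of
  `…R3PurseNodes` at `P := halfPurse` with `hP := typedPurse_le_halfPurse` and `extraQ halfPurse = halfBudget`);
* the capital form `RateLawsHalfCapQ` {`FarLawQ aF`, `ConsLawQ aC`, `ApproachAllowanceQ (residualBudgetQ aF aC + halfBudget)`} with
  `restRateBotPQ_half_of_laws`, the bridge `rateLawsHalfCapQ_of_rateLaws` (`farLawQ_of_energyLawC_rises`), the per-frame reading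
  `approachBudgetHalf_apply` of socket A's allowance, and `law421Half_of_succ_rateLaws : RestSuccBotQ → RateLawsHalfQ → Law421P halfPurse`.
K = bookkeeping over landed doors; whether the four laws HOLD is open analysis (map §3).  Nothing here bears on the truth of RH; RH is NOT proved;
33346 / 33347 / 24730 OPEN. -/

namespace RhW08.RateSplit

open Complex
open RhIdea6.G17.W07C7 RhIdea6.G17.W07C7.Rev6 RhIdea6.G18.W07C8.Law421BirthS RhIdea6.G19.W07C11.Seam
open RhIdea6.G20.W07C12.Frac RhIdea6.G20.W07C12.StColP RhW07.C12.FieldSplit RhIdea6.G21.W07C13.TentMax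
open RhW07.C14.TwoSided RhW07.C14.Classes RhW07.C14.Lineage RhW07.C14.Booking
open RhW07.C13.Heredity RhIdea6.G22.W07C15pre.Injection RhW07.E3.Cell
open RhW07.E3.Lit
open RhW08.Round1 RhW08.StSwap RhW08.Round2 RhW08.QuadW
open RhW08.SealSwap (PBot)
open RhW08.SealSwapQ
open RhW08.PurseP

section HalfPurseFacts

/-- (K) the ½ purse's extra capital over the rate purse is `halfBudget = (B+1)/2`. -/
theorem extraQ_halfPurse : extraQ halfPurse = halfBudget := by
  funext η f x₀ s hmax R Hs B
  simp only [extraQ, halfPurse, ratePurseQ, halfBudget]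
  ring

/-- (K) the typed purse is below the ½ purse, in the `hP` shape the generic-purse doors of `…R3PurseNodes` take. -/
theorem hP_half : ∀ (f : ℂ → ℂ) (x₀ s hmax R Hs : ℝ) (B : ℕ), 0 < s → typedPurse f x₀ s hmax R Hs B ≤ halfPurse f x₀ s hmax R Hs B :=
  fun f x₀ s hmax R Hs B _ => typedPurse_le_halfPurse f x₀ s hmax R Hs B

/-- (K) `residualBudgetPQ halfPurse aF aC = residualBudgetQ aF aC + halfBudget`. -/
theorem residualBudgetPQ_halfPurse (aF aC : Budget) :
    residualBudgetPQ halfPurse aF aC = addBudget (residualBudgetQ aF aC) halfBudget := by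
  rw [residualBudgetPQ_eq_add, extraQ_halfPurse]

end HalfPurseFacts

section Sockets

/-- (T) socket A's allowance at the ½ purse in ENERGY form: `S₀ − (4/5)⁻¹·energyPurseQ − (4/5)⁻¹·aR − aC + (B+1)/2`. -/
noncomputable def approachBudgetHalfQ (aR aC : Budget) : Budget :=
  addBudget (residualBudgetQ (addBudget (scaleBudgetQ (4 / 5)⁻¹ energyPurseQ) (scaleBudgetQ (4 / 5)⁻¹ aR)) aC) halfBudget

/-- (K) per-frame reading of socket A's allowance: `slack0Q − (5/4)·energyPurseQ − (5/4)·aR − aC + (B+1)/2`. -/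
theorem approachBudgetHalf_apply (aR aC : Budget) (η : ℝ) (f : ℂ → ℂ) (x₀ s hmax R Hs : ℝ) (B : ℕ) :
    approachBudgetHalfQ aR aC η f x₀ s hmax R Hs B =
      slack0Q η f x₀ s hmax R Hs B - 5 / 4 * energyPurseQ η f x₀ s hmax R Hs B - 5 / 4 * aR η f x₀ s hmax R Hs B
        - aC η f x₀ s hmax R Hs B + ((B : ℝ) + 1) / 2 := by
  have h : (4 / 5 : ℝ)⁻¹ = 5 / 4 := by norm_num
  simp only [approachBudgetHalfQ, addBudget, residualBudgetQ, scaleBudgetQ, halfBudget, h]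
  ring

/-- (T, OPEN) (CA422) RESIDUAL-DESIGNATE of the RATE^B stub at the ½ purse — the four law sockets F1 / F2 / C / A of the endgame map as ONE closed
statement (energy form): F1 ⇒ `FarEnergyLawCQ (4/5)`, F2 `EnergyRiseLawQ aR`, C `ConsLawQ aC`, ★A `ApproachAllowanceQ (approachBudgetHalfQ aR aC)`
(spelled out).  Censuses certify the SUM in-model at κ = ½ (0/53, 0/158, 0/1 288 NEG), not the split; F1 is vacuous on every censused family. -/
def RateLawsHalfQ : Prop :=
  ∃ aR aC : Budget, FarEnergyLawCQ (4 / 5) ∧ EnergyRiseLawQ aR ∧ ConsLawQ aC ∧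
    ApproachAllowanceQ (addBudget (residualBudgetQ (addBudget (scaleBudgetQ (4 / 5)⁻¹ energyPurseQ) (scaleBudgetQ (4 / 5)⁻¹ aR)) aC) halfBudget)

/-- (T, OPEN) the CAPITAL form of the same split: F `FarLawQ aF`, C `ConsLawQ aC`, A `ApproachAllowanceQ (residualBudgetQ aF aC + halfBudget)`
(the form the κ = ½ tables price: per frame `S₀ − aF − aC + (B+1)/2`). -/
def RateLawsHalfCapQ : Prop :=
  ∃ aF aC : Budget, FarLawQ aF ∧ ConsLawQ aC ∧ ApproachAllowanceQ (addBudget (residualBudgetQ aF aC) halfBudget)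

/-- (K) energy form ⇒ capital form, with `aF := (4/5)⁻¹·energyPurseQ + (4/5)⁻¹·aR` (`farLawQ_of_energyLawC_rises`). -/
theorem rateLawsHalfCapQ_of_rateLaws (h : RateLawsHalfQ) : RateLawsHalfCapQ := by
  obtain ⟨aR, aC, hR2, hr, hC, hA⟩ := h
  exact ⟨_, aC, farLawQ_of_energyLawC_rises (c := 4 / 5) (by norm_num) hR2 hr, hC, hA⟩

end Sockets

section Stub

/-- (K) ★ the RATE^B stub text from the CAPITAL-form laws: `restRateBotPQ_of_capitalFunded'` at `P := halfPurse`. -/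
theorem restRateBotPQ_half_of_laws (h : RateLawsHalfCapQ) : RestRateBotPQ halfPurse := by
  obtain ⟨aF, aC, hF, hC, hA⟩ := h
  exact restRateBotPQ_of_capitalFunded' hP_half hF hC (by rw [extraQ_halfPurse]; exact hA)

/-- (K) ★★ the RATE^B stub text from the ENERGY-form laws (= `RateLawsHalfQ`, the residual-designate): `restRateBotPQ_of_energyLawC` at `P := halfPurse`. -/
theorem restRateBotPQ_half_of_rateLaws (h : RateLawsHalfQ) : RestRateBotPQ halfPurse := by
  obtain ⟨aR, aC, hR2, hr, hC, hA⟩ := h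
  exact restRateBotPQ_of_energyLawC hP_half (by norm_num) hR2 hr hC (by rw [residualBudgetPQ_eq_add, extraQ_halfPurse]; exact hA)

/-- (K) the two routes agree: the energy form also closes through the capital door. -/
theorem restRateBotPQ_half_of_rateLaws' (h : RateLawsHalfQ) : RestRateBotPQ halfPurse :=
  restRateBotPQ_half_of_laws (rateLawsHalfCapQ_of_rateLaws h)

/-- (K) socket form with the laws as separate hypotheses (the shape a skeleton's `_of` consumes). -/
theorem restRateBotPQ_half_of_sockets {aR aC : Budget} (hR2 : FarEnergyLawCQ (4 / 5)) (hr : EnergyRiseLawQ aR) (hC : ConsLawQ aC)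
    (hA : ApproachAllowanceQ (approachBudgetHalfQ aR aC)) : RestRateBotPQ halfPurse :=
  restRateBotPQ_half_of_rateLaws ⟨aR, aC, hR2, hr, hC, hA⟩

/-- (K) SUCC + the four RATE laws ⇒ the κ = ½ law text `Law421P halfPurse` (= the crux `TiltedLandingLaw421R` read through `law421Half_iff_text`). -/
theorem law421Half_of_succ_rateLaws (hS : RestSuccBotQ) (hL : RateLawsHalfQ) : Law421P halfPurse :=
  law421Half_of_succ_rate hS (restRateBotPQ_half_of_rateLaws hL)

/-- (K) capital-form variant of the previous. -/
theorem law421Half_of_succ_laws (hS : RestSuccBotQ) (hL : RateLawsHalfCapQ) : Law421P halfPurse :=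
  law421Half_of_succ_rate hS (restRateBotPQ_half_of_laws hL)

end Stub

end RhW08.RateSplit
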